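import Mathlib
import HarnessLib
import Literature.Geometry.DiscreteGeometry.BondGraph
import Literature.Geometry.DiscreteGeometry.KissingPatterns
import Literature.MathematicalPhysics.StatisticalMechanics.BarlowStacking
import Literature.MathematicalPhysics.StatisticalMechanics.HaggStacking
import Summits.AtomisticToContinuum.Crystallization.Theorems.PricedLinkCensusSoftLayerPropagationStubDevelopReach
import Summits.AtomisticToContinuum.Crystallization.Theorems.PricedLinkCensusSoftLayerPropagationRealBallCovering

/-!
# `stub_realBall` (crux `SoftLayerPropagation`, line `Sketch` v7): reduction of the real-ball
# inclusion to rigid tracking of the graph `5`-ball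

Route `PricedLinkCensus`, crux `SoftLayerPropagation` (stmt-AtomisticToContinuum-14233), line
`Sketch`, registered stub `stub_realBall`: under the hypotheses of the line (charge-free
`8·nn_i`-ball at `η ≤ 1/100`, the exact development `D` on the graph `5`-ball, one Barlow
stacking on the shadow `33/10`-ball), every site `j` of the REAL ball `dist (y i) (y j) ≤ 3 nn_i`
lies in the graph `5`-ball and has shadow within `33/10` of `D i`.

This file proves the stub FROM AN EXPLICIT TRACKING HYPOTHESIS (the shape of the line's
`stub_licence`, with a larger radius): one rigid motion `g` of real space with
`dist (y v) (g (nn_i • φ (D v))) ≤ e · nn_i` for the sites `v` of the graph `5`-ball with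
`dist (D v) (D i) ≤ R`.  THE SPECIFICATION (`realBall_of_tracking`): any `e ≤ 3/20` and
`R ≥ 3 + e + 31/40` (e.g. `(R, e) = (157/40, 3/20)`); more flexibly
(`realBall_of_tracking_tiers`) three tiers `(0, e₀)`, `(R₁, e₁)`, `(R₂, e₂)` — the centre alone,
a near radius, a far radius — with `e₀ ≤ 3/20`, `e₀ + e₁ ≤ 3/10`, `e₂ ≤ 7/40`,
`R₁ ≥ 3 + e₀ + e₂`, `R₂ ≥ 3 + e₀ + 31/40` (e.g. `e₀ = e₁ = 3/20` at `R₁ = 133/40 = 3.325` and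
`e₂ = 7/40` at `R₂ = 157/40 = 3.925`).

PROOF (no stacking structure, no charge-freeness beyond `nn_i > 0`, no chart is used — only the
exact stars, the tracking, the hard core and the scale comparison along bonds).  Put
`x := φ⁻¹ (nn_i⁻¹ • g⁻¹ (y j))`, the shadow position of `y j`; tracking at the centre gives
`‖x - D i‖ ≤ 3 + e₀ ≤ 63/20`.  FIVE MOVES (`RealBall.exists_walk_norm_sub_le`,
`…RealBallCovering.lean`: from any developed site some bond-neighbour's exact shadow direction is
within `45°` of the direction to `x`, the inradius `1/√2` of the cuboctahedron / anticuboctahedron)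
give a site `v` at graph distance `≤ 5` with `‖x - D v‖ ≤ 31/40`, hence
`dist (D v) (D i) ≤ 3 + e₀ + 31/40 ≤ R₂`; far tracking of `v` gives
`dist (y j) (y v) ≤ (31/40 + e₂) nn_i ≤ (19/20) nn_i`, while along the walk
`nn_i ≤ 1.01⁵ nn_v` (`develop_reach`) and every site other than `v` is at distance `≥ nn_v` from
`y v` (`nearestDist_le_dist`): since `(19/20)·1.01⁵ < 1`, `j = v`.  So `j` is in the graph
`5`-ball; far tracking of `j` gives `‖x - D j‖ ≤ e₂`, so `dist (D j) (D i) ≤ 3 + e₀ + e₂ ≤ R₁`,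
near tracking gives `‖x - D j‖ ≤ e₁`, and `dist (D j) (D i) ≤ 3 + e₀ + e₁ ≤ 33/10`.

Why these constants are what the argument yields: `e₀ + e₁ ≤ 3/10` is forced by reading the shadow
radius off the real radius `3` through the tracking at both ends; the far tolerance by the
covering constant `31/40` of five `45°`-moves from `63/20` against the hard core `1/1.01⁵`; the far
radius by `3 + e₀ + 31/40`.  All [folklore].
-/

noncomputable section

namespace Summit.AtomisticToContinuum.Crystallization.Theorems

open Literature.Geometry.DiscreteGeometry Literature.MathematicalPhysics.StatisticalMechanics

/-- **`stub_realBall` from three-tier tracking.**  Under the hypotheses of the registered stub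
`stub_realBall` of line `Sketch` (verbatim, in order: `η ∈ (0, 1/100]`, `nn_i > 0`, charge-free
`8·nn_i`-ball, exact stars on the graph `5`-ball, Hägg sequence, membership / surjectivity /
injectivity of the stacking at shadow radius `33/10`), and given tolerances `e₀ ≤ 3/20`,
`e₀ + e₁ ≤ 3/10`, `e₂ ≤ 7/40` and radii `R₁ ≥ 3 + e₀ + e₂`, `R₂ ≥ 3 + e₀ + 31/40`, IF one rigid
motion `g` tracks the centre to `e₀ nn_i`, the graph-`5`-ball sites with shadow within `R₁` of
`D i` to `e₁ nn_i` and those with shadow within `R₂` to `e₂ nn_i`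
(`dist (y v) (g (nn_i • φ (D v))) ≤ e · nn_i`), THEN every site `j` with
`dist (y i) (y j) ≤ 3 nn_i` is in the graph `5`-ball with `dist (D j) (D i) ≤ 33/10`.
(The stacking hypotheses are carried only to match the stub; the proof does not use them.)
[folklore] -/
theorem realBall_of_tracking_tiers :
    ∀ η : ℝ, 0 < η → η ≤ 1 / 100 →
      ∀ (N : ℕ) (y : Fin N → EuclideanSpace ℝ (Fin 3)) (i : Fin N),
        0 < Literature.Geometry.DiscreteGeometry.nearestDist y i →
        (∀ j : Fin N, dist (y i) (y j) ≤ 8 * Literature.Geometry.DiscreteGeometry.nearestDist y i →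
          Literature.Geometry.DiscreteGeometry.IsChargeFree η y j) →
        ∀ (D : Fin N → EuclideanSpace ℝ (Fin 3))
          (φ : EuclideanSpace ℝ (Fin 3) ≃ᵃⁱ[ℝ] EuclideanSpace ℝ (Fin 3)) (s : ℤ → ℤ),
          (∀ j : Fin N, (∃ w : (Literature.Geometry.DiscreteGeometry.bondGraph η y).Walk i j, w.length ≤ 5) →
            ∃ (P : Finset (EuclideanSpace ℝ (Fin 3)))
              (Q R : EuclideanSpace ℝ (Fin 3) →ₗᵢ[ℝ] EuclideanSpace ℝ (Fin 3)),
              (P = Literature.Geometry.DiscreteGeometry.fccKissingPattern ∨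
                P = Literature.Geometry.DiscreteGeometry.hcpKissingPattern) ∧
              D '' {k | (Literature.Geometry.DiscreteGeometry.bondGraph η y).Adj j k} =
                (fun p => D j + Q p) '' (P : Set (EuclideanSpace ℝ (Fin 3))) ∧
              (∀ k, (Literature.Geometry.DiscreteGeometry.bondGraph η y).Adj j k →
                ‖(y k - y j) - Literature.Geometry.DiscreteGeometry.nearestDist y j • R (D k - D j)‖ ≤
                  Literature.Geometry.DiscreteGeometry.nearestDist y j / 4) ∧
              (∀ k k', (Literature.Geometry.DiscreteGeometry.bondGraph η y).Adj j k →
                (Literature.Geometry.DiscreteGeometry.bondGraph η y).Adj j k' →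
                ((Literature.Geometry.DiscreteGeometry.bondGraph η y).Adj k k' ↔
                  dist (D k) (D k') = 1))) →
          Literature.MathematicalPhysics.StatisticalMechanics.IsHaggSeq s →
          (∀ j : Fin N, (∃ w : (Literature.Geometry.DiscreteGeometry.bondGraph η y).Walk i j, w.length ≤ 5) →
            dist (D j) (D i) ≤ 33 / 10 →
            φ (D j) ∈ Literature.MathematicalPhysics.StatisticalMechanics.barlowStacking 1
              (Real.sqrt (2 / 3)) s) →
          (∀ z ∈ Literature.MathematicalPhysics.StatisticalMechanics.barlowStacking 1
              (Real.sqrt (2 / 3)) s,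
            dist z (φ (D i)) ≤ 33 / 10 →
            ∃ j : Fin N, (∃ w : (Literature.Geometry.DiscreteGeometry.bondGraph η y).Walk i j,
              w.length ≤ 5) ∧ dist (D j) (D i) ≤ 33 / 10 ∧ φ (D j) = z) →
          (∀ j k : Fin N, (∃ w : (Literature.Geometry.DiscreteGeometry.bondGraph η y).Walk i j, w.length ≤ 5) →
            (∃ w : (Literature.Geometry.DiscreteGeometry.bondGraph η y).Walk i k, w.length ≤ 5) →
            dist (D j) (D i) ≤ 33 / 10 → dist (D k) (D i) ≤ 33 / 10 → D j = D k → j = k) →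
          ∀ (e₀ e₁ e₂ R₁ R₂ : ℝ), e₀ ≤ 3 / 20 → e₀ + e₁ ≤ 3 / 10 → e₂ ≤ 7 / 40 →
            3 + e₀ + e₂ ≤ R₁ → 3 + e₀ + 31 / 40 ≤ R₂ →
          (∃ g : EuclideanSpace ℝ (Fin 3) ≃ᵃⁱ[ℝ] EuclideanSpace ℝ (Fin 3),
            dist (y i) (g (Literature.Geometry.DiscreteGeometry.nearestDist y i • φ (D i))) ≤
                e₀ * Literature.Geometry.DiscreteGeometry.nearestDist y i ∧
            (∀ j : Fin N, (∃ w : (Literature.Geometry.DiscreteGeometry.bondGraph η y).Walk i j, w.length ≤ 5) →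
              dist (D j) (D i) ≤ R₁ →
              dist (y j) (g (Literature.Geometry.DiscreteGeometry.nearestDist y i • φ (D j))) ≤
                e₁ * Literature.Geometry.DiscreteGeometry.nearestDist y i) ∧
            (∀ j : Fin N, (∃ w : (Literature.Geometry.DiscreteGeometry.bondGraph η y).Walk i j, w.length ≤ 5) →
              dist (D j) (D i) ≤ R₂ →
              dist (y j) (g (Literature.Geometry.DiscreteGeometry.nearestDist y i • φ (D j))) ≤
                e₂ * Literature.Geometry.DiscreteGeometry.nearestDist y i)) →
          ∀ j : Fin N, dist (y i) (y j) ≤ 3 * Literature.Geometry.DiscreteGeometry.nearestDist y i →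
            (∃ w : (Literature.Geometry.DiscreteGeometry.bondGraph η y).Walk i j, w.length ≤ 5) ∧
              dist (D j) (D i) ≤ 33 / 10 := by
  intro η hη hη1 N y i hpos _hcf D φ s hD _hs _hmem _hsurj _hinj e₀ e₁ e₂ R₁ R₂ he₀ he₀₁ he₂ hR₁ hR₂
    ⟨g, hg₀, hg₁, hg₂⟩ j hj
  set ν := nearestDist y i with hν
  -- the shadow position of `y j`
  set x : EuclideanSpace ℝ (Fin 3) := φ.symm (ν⁻¹ • g.symm (y j)) with hx
  have hgx : g (ν • φ x) = y j := by
    simp [hx, smul_smul, mul_inv_cancel₀ hpos.ne']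
  have key : ∀ v : Fin N, dist (y j) (g (ν • φ (D v))) = ν * ‖x - D v‖ := by
    intro v
    rw [← hgx, g.dist_map, dist_smul₀, Real.norm_of_nonneg hpos.le, φ.dist_map, dist_eq_norm]
  -- nonnegativity of the tolerances actually used
  have he₀0 : 0 ≤ e₀ := nonneg_of_mul_nonneg_left (dist_nonneg.trans hg₀) hpos
  have hwi : ∃ w : (bondGraph η y).Walk i i, w.length ≤ 5 := ⟨SimpleGraph.Walk.nil, by simp⟩
  have he₂0 : 0 ≤ e₂ := by
    have h := hg₂ i hwi (by rw [dist_self]; linarith)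
    exact nonneg_of_mul_nonneg_left (dist_nonneg.trans h) hpos
  -- the centre is tracked: `‖x - D i‖ ≤ 3 + e₀`
  have hxi : ‖x - D i‖ ≤ 3 + e₀ := by
    have h1 : dist (y j) (g (ν • φ (D i))) ≤ dist (y j) (y i) + dist (y i) (g (ν • φ (D i))) :=
      dist_triangle _ _ _
    rw [key, dist_comm (y j)] at h1
    have h2 : ν * ‖x - D i‖ ≤ ν * (3 + e₀) := by linarith
    exact le_of_mul_le_mul_left h2 hpos
  -- five moves in the development: a graph-`5`-ball site within `31/40` of `x`
  obtain ⟨v, ⟨w, hw⟩, hv⟩ := RealBall.exists_walk_norm_sub_le hD x (hxi.trans (by linarith))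
  -- it is far-tracked, hence within `(31/40 + e₂) ν` of `y j` in real space
  have hvR : dist (D v) (D i) ≤ R₂ := by
    rw [dist_eq_norm]
    have := norm_sub_le_norm_sub_add_norm_sub (D v) x (D i)
    rw [norm_sub_rev (D v) x] at this
    linarith
  have htv := hg₂ v ⟨w, hw⟩ hvR
  have hjv : dist (y v) (y j) ≤ (31 / 40 + e₂) * ν := by
    have h1 : dist (y j) (y v) ≤ dist (y j) (g (ν • φ (D v))) + dist (g (ν • φ (D v))) (y v) :=
      dist_triangle _ _ _
    rw [key, dist_comm (g _)] at h1
    rw [dist_comm]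
    nlinarith [mul_le_mul_of_nonneg_left hv hpos.le]
  -- comparable scales along the walk: `ν ≤ 1.01⁵ nn_v`
  have hνv : ν ≤ (101 / 100 : ℝ) ^ 5 * nearestDist y v := by
    have h3 := (develop_reach η hη.le N y i v w).2.2
    have hb : (1 : ℝ) ≤ 1 + η := by linarith
    have hpow : (1 + η) ^ w.length ≤ (101 / 100 : ℝ) ^ 5 :=
      (pow_le_pow_right₀ hb hw).trans (pow_le_pow_left₀ (by linarith) (by linarith) 5)
    exact h3.trans (mul_le_mul_of_nonneg_right hpow (nearestDist_nonneg y v))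
  -- hard core: `j = v`
  have hjv_eq : j = v := by
    by_contra hne
    have hcore : nearestDist y v ≤ dist (y v) (y j) := nearestDist_le_dist y hne
    have h19 : (31 / 40 + e₂) * ν ≤ 19 / 20 * ν := mul_le_mul_of_nonneg_right (by linarith) hpos.le
    norm_num at hνv
    linarith
  subst hjv_eq
  refine ⟨⟨w, hw⟩, ?_⟩
  -- `j` is far-tracked, then near-tracked
  have hxj₂ : ‖x - D j‖ ≤ e₂ := by
    have h1 := htv
    rw [key] at h1
    have h2 : ν * ‖x - D j‖ ≤ ν * e₂ := by linarith
    exact le_of_mul_le_mul_left h2 hpos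
  have hjR₁ : dist (D j) (D i) ≤ R₁ := by
    rw [dist_eq_norm]
    have := norm_sub_le_norm_sub_add_norm_sub (D j) x (D i)
    rw [norm_sub_rev (D j) x] at this
    linarith
  have htj := hg₁ j ⟨w, hw⟩ hjR₁
  rw [key] at htj
  have hxj₁ : ‖x - D j‖ ≤ e₁ := by
    have h2 : ν * ‖x - D j‖ ≤ ν * e₁ := by linarith
    exact le_of_mul_le_mul_left h2 hpos
  rw [dist_eq_norm]
  have := norm_sub_le_norm_sub_add_norm_sub (D j) x (D i)
  rw [norm_sub_rev (D j) x] at this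
  linarith

/-- **`stub_realBall` from one-tier tracking** (the specification for `stub_licence`).  Under the
hypotheses of the registered stub `stub_realBall` (verbatim), for any tolerance `0 ≤ e ≤ 3/20` and
radius `R ≥ 3 + e + 31/40`: IF one rigid motion `g` of real space has
`dist (y v) (g (nn_i • φ (D v))) ≤ e · nn_i` for every site `v` of the graph `5`-ball with
`dist (D v) (D i) ≤ R` — the conclusion of `stub_licence` with `(33/10, nn_i/6)` replaced by
`(R, e · nn_i)`, e.g. `(157/40, 3/20)` — THEN every site `j` with `dist (y i) (y j) ≤ 3 nn_i` is in
the graph `5`-ball with `dist (D j) (D i) ≤ 33/10`.  (`realBall_of_tracking_tiers` with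
`e₀ = e₁ = e₂ = e`, `R₁ = R₂ = R`.) [folklore] -/
theorem realBall_of_tracking :
    ∀ η : ℝ, 0 < η → η ≤ 1 / 100 →
      ∀ (N : ℕ) (y : Fin N → EuclideanSpace ℝ (Fin 3)) (i : Fin N),
        0 < Literature.Geometry.DiscreteGeometry.nearestDist y i →
        (∀ j : Fin N, dist (y i) (y j) ≤ 8 * Literature.Geometry.DiscreteGeometry.nearestDist y i →
          Literature.Geometry.DiscreteGeometry.IsChargeFree η y j) →
        ∀ (D : Fin N → EuclideanSpace ℝ (Fin 3))
          (φ : EuclideanSpace ℝ (Fin 3) ≃ᵃⁱ[ℝ] EuclideanSpace ℝ (Fin 3)) (s : ℤ → ℤ),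
          (∀ j : Fin N, (∃ w : (Literature.Geometry.DiscreteGeometry.bondGraph η y).Walk i j, w.length ≤ 5) →
            ∃ (P : Finset (EuclideanSpace ℝ (Fin 3)))
              (Q R : EuclideanSpace ℝ (Fin 3) →ₗᵢ[ℝ] EuclideanSpace ℝ (Fin 3)),
              (P = Literature.Geometry.DiscreteGeometry.fccKissingPattern ∨
                P = Literature.Geometry.DiscreteGeometry.hcpKissingPattern) ∧
              D '' {k | (Literature.Geometry.DiscreteGeometry.bondGraph η y).Adj j k} =
                (fun p => D j + Q p) '' (P : Set (EuclideanSpace ℝ (Fin 3))) ∧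
              (∀ k, (Literature.Geometry.DiscreteGeometry.bondGraph η y).Adj j k →
                ‖(y k - y j) - Literature.Geometry.DiscreteGeometry.nearestDist y j • R (D k - D j)‖ ≤
                  Literature.Geometry.DiscreteGeometry.nearestDist y j / 4) ∧
              (∀ k k', (Literature.Geometry.DiscreteGeometry.bondGraph η y).Adj j k →
                (Literature.Geometry.DiscreteGeometry.bondGraph η y).Adj j k' →
                ((Literature.Geometry.DiscreteGeometry.bondGraph η y).Adj k k' ↔
                  dist (D k) (D k') = 1))) →
          Literature.MathematicalPhysics.StatisticalMechanics.IsHaggSeq s →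
          (∀ j : Fin N, (∃ w : (Literature.Geometry.DiscreteGeometry.bondGraph η y).Walk i j, w.length ≤ 5) →
            dist (D j) (D i) ≤ 33 / 10 →
            φ (D j) ∈ Literature.MathematicalPhysics.StatisticalMechanics.barlowStacking 1
              (Real.sqrt (2 / 3)) s) →
          (∀ z ∈ Literature.MathematicalPhysics.StatisticalMechanics.barlowStacking 1
              (Real.sqrt (2 / 3)) s,
            dist z (φ (D i)) ≤ 33 / 10 →
            ∃ j : Fin N, (∃ w : (Literature.Geometry.DiscreteGeometry.bondGraph η y).Walk i j,
              w.length ≤ 5) ∧ dist (D j) (D i) ≤ 33 / 10 ∧ φ (D j) = z) →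
          (∀ j k : Fin N, (∃ w : (Literature.Geometry.DiscreteGeometry.bondGraph η y).Walk i j, w.length ≤ 5) →
            (∃ w : (Literature.Geometry.DiscreteGeometry.bondGraph η y).Walk i k, w.length ≤ 5) →
            dist (D j) (D i) ≤ 33 / 10 → dist (D k) (D i) ≤ 33 / 10 → D j = D k → j = k) →
          ∀ (e R : ℝ), 0 ≤ e → e ≤ 3 / 20 → 3 + e + 31 / 40 ≤ R →
          (∃ g : EuclideanSpace ℝ (Fin 3) ≃ᵃⁱ[ℝ] EuclideanSpace ℝ (Fin 3),
            ∀ j : Fin N, (∃ w : (Literature.Geometry.DiscreteGeometry.bondGraph η y).Walk i j, w.length ≤ 5) →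
              dist (D j) (D i) ≤ R →
              dist (y j) (g (Literature.Geometry.DiscreteGeometry.nearestDist y i • φ (D j))) ≤
                e * Literature.Geometry.DiscreteGeometry.nearestDist y i) →
          ∀ j : Fin N, dist (y i) (y j) ≤ 3 * Literature.Geometry.DiscreteGeometry.nearestDist y i →
            (∃ w : (Literature.Geometry.DiscreteGeometry.bondGraph η y).Walk i j, w.length ≤ 5) ∧
              dist (D j) (D i) ≤ 33 / 10 := by
  intro η hη hη1 N y i hpos hcf D φ s hD hs hmem hsurj hinj e R he0 he hR ⟨g, hg⟩
  have hwi : ∃ w : (bondGraph η y).Walk i i, w.length ≤ 5 := ⟨SimpleGraph.Walk.nil, by simp⟩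
  have hgi := hg i hwi (by rw [dist_self]; linarith)
  exact realBall_of_tracking_tiers η hη hη1 N y i hpos hcf D φ s hD hs hmem hsurj hinj e e e R R he
    (by linarith) (by linarith) (by linarith) hR ⟨g, hgi, hg, hg⟩

/-- **`stub_realBall` from the licence at `(157/40, 3/20 · nn_i)`.**  If the tracking theorem of
the line holds with shadow radius `157/40` and tolerance `3/20 · nn_i` (hypothesis: the statement
of `stub_licence` verbatim with `33/10 ↦ 157/40` in the radius premise of its conclusion and
`nn_i / 6 ↦ 3/20 · nn_i`), then the registered stub `stub_realBall` holds (conclusion: its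
signature verbatim).  This is the exact open debt left by this file. [folklore] -/
theorem stub_realBall_of_licence
    (hlic :
      ∀ η : ℝ, 0 < η → η ≤ 1 / 100 →
        ∀ (N : ℕ) (y : Fin N → EuclideanSpace ℝ (Fin 3)) (i : Fin N),
          0 < Literature.Geometry.DiscreteGeometry.nearestDist y i →
          (∀ j : Fin N, dist (y i) (y j) ≤ 8 * Literature.Geometry.DiscreteGeometry.nearestDist y i →
            Literature.Geometry.DiscreteGeometry.IsChargeFree η y j) →
          ∀ (D : Fin N → EuclideanSpace ℝ (Fin 3))
            (φ : EuclideanSpace ℝ (Fin 3) ≃ᵃⁱ[ℝ] EuclideanSpace ℝ (Fin 3)) (s : ℤ → ℤ),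
            (∀ j : Fin N, (∃ w : (Literature.Geometry.DiscreteGeometry.bondGraph η y).Walk i j, w.length ≤ 5) →
              ∃ (P : Finset (EuclideanSpace ℝ (Fin 3)))
                (Q R : EuclideanSpace ℝ (Fin 3) →ₗᵢ[ℝ] EuclideanSpace ℝ (Fin 3)),
                (P = Literature.Geometry.DiscreteGeometry.fccKissingPattern ∨
                  P = Literature.Geometry.DiscreteGeometry.hcpKissingPattern) ∧
                D '' {k | (Literature.Geometry.DiscreteGeometry.bondGraph η y).Adj j k} =
                  (fun p => D j + Q p) '' (P : Set (EuclideanSpace ℝ (Fin 3))) ∧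
                (∀ k, (Literature.Geometry.DiscreteGeometry.bondGraph η y).Adj j k →
                  ‖(y k - y j) - Literature.Geometry.DiscreteGeometry.nearestDist y j • R (D k - D j)‖ ≤
                    Literature.Geometry.DiscreteGeometry.nearestDist y j / 4) ∧
                (∀ k k', (Literature.Geometry.DiscreteGeometry.bondGraph η y).Adj j k →
                  (Literature.Geometry.DiscreteGeometry.bondGraph η y).Adj j k' →
                  ((Literature.Geometry.DiscreteGeometry.bondGraph η y).Adj k k' ↔
                    dist (D k) (D k') = 1))) →
            Literature.MathematicalPhysics.StatisticalMechanics.IsHaggSeq s →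
            (∀ j : Fin N, (∃ w : (Literature.Geometry.DiscreteGeometry.bondGraph η y).Walk i j, w.length ≤ 5) →
              dist (D j) (D i) ≤ 33 / 10 →
              φ (D j) ∈ Literature.MathematicalPhysics.StatisticalMechanics.barlowStacking 1
                (Real.sqrt (2 / 3)) s) →
            (∀ z ∈ Literature.MathematicalPhysics.StatisticalMechanics.barlowStacking 1
                (Real.sqrt (2 / 3)) s,
              dist z (φ (D i)) ≤ 33 / 10 →
              ∃ j : Fin N, (∃ w : (Literature.Geometry.DiscreteGeometry.bondGraph η y).Walk i j,
                w.length ≤ 5) ∧ dist (D j) (D i) ≤ 33 / 10 ∧ φ (D j) = z) →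
            (∀ j k : Fin N, (∃ w : (Literature.Geometry.DiscreteGeometry.bondGraph η y).Walk i j, w.length ≤ 5) →
              (∃ w : (Literature.Geometry.DiscreteGeometry.bondGraph η y).Walk i k, w.length ≤ 5) →
              dist (D j) (D i) ≤ 33 / 10 → dist (D k) (D i) ≤ 33 / 10 → D j = D k → j = k) →
            ∃ g : EuclideanSpace ℝ (Fin 3) ≃ᵃⁱ[ℝ] EuclideanSpace ℝ (Fin 3),
              ∀ j : Fin N, (∃ w : (Literature.Geometry.DiscreteGeometry.bondGraph η y).Walk i j, w.length ≤ 5) →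
                dist (D j) (D i) ≤ 157 / 40 →
                dist (y j) (g (Literature.Geometry.DiscreteGeometry.nearestDist y i • φ (D j))) ≤
                  3 / 20 * Literature.Geometry.DiscreteGeometry.nearestDist y i) :
    ∀ η : ℝ, 0 < η → η ≤ 1 / 100 →
      ∀ (N : ℕ) (y : Fin N → EuclideanSpace ℝ (Fin 3)) (i : Fin N),
        0 < Literature.Geometry.DiscreteGeometry.nearestDist y i →
        (∀ j : Fin N, dist (y i) (y j) ≤ 8 * Literature.Geometry.DiscreteGeometry.nearestDist y i →
          Literature.Geometry.DiscreteGeometry.IsChargeFree η y j) →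
        ∀ (D : Fin N → EuclideanSpace ℝ (Fin 3))
          (φ : EuclideanSpace ℝ (Fin 3) ≃ᵃⁱ[ℝ] EuclideanSpace ℝ (Fin 3)) (s : ℤ → ℤ),
          (∀ j : Fin N, (∃ w : (Literature.Geometry.DiscreteGeometry.bondGraph η y).Walk i j, w.length ≤ 5) →
            ∃ (P : Finset (EuclideanSpace ℝ (Fin 3)))
              (Q R : EuclideanSpace ℝ (Fin 3) →ₗᵢ[ℝ] EuclideanSpace ℝ (Fin 3)),
              (P = Literature.Geometry.DiscreteGeometry.fccKissingPattern ∨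
                P = Literature.Geometry.DiscreteGeometry.hcpKissingPattern) ∧
              D '' {k | (Literature.Geometry.DiscreteGeometry.bondGraph η y).Adj j k} =
                (fun p => D j + Q p) '' (P : Set (EuclideanSpace ℝ (Fin 3))) ∧
              (∀ k, (Literature.Geometry.DiscreteGeometry.bondGraph η y).Adj j k →
                ‖(y k - y j) - Literature.Geometry.DiscreteGeometry.nearestDist y j • R (D k - D j)‖ ≤
                  Literature.Geometry.DiscreteGeometry.nearestDist y j / 4) ∧
              (∀ k k', (Literature.Geometry.DiscreteGeometry.bondGraph η y).Adj j k →
                (Literature.Geometry.DiscreteGeometry.bondGraph η y).Adj j k' →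
                ((Literature.Geometry.DiscreteGeometry.bondGraph η y).Adj k k' ↔
                  dist (D k) (D k') = 1))) →
          Literature.MathematicalPhysics.StatisticalMechanics.IsHaggSeq s →
          (∀ j : Fin N, (∃ w : (Literature.Geometry.DiscreteGeometry.bondGraph η y).Walk i j, w.length ≤ 5) →
            dist (D j) (D i) ≤ 33 / 10 →
            φ (D j) ∈ Literature.MathematicalPhysics.StatisticalMechanics.barlowStacking 1
              (Real.sqrt (2 / 3)) s) →
          (∀ z ∈ Literature.MathematicalPhysics.StatisticalMechanics.barlowStacking 1
              (Real.sqrt (2 / 3)) s,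
            dist z (φ (D i)) ≤ 33 / 10 →
            ∃ j : Fin N, (∃ w : (Literature.Geometry.DiscreteGeometry.bondGraph η y).Walk i j,
              w.length ≤ 5) ∧ dist (D j) (D i) ≤ 33 / 10 ∧ φ (D j) = z) →
          (∀ j k : Fin N, (∃ w : (Literature.Geometry.DiscreteGeometry.bondGraph η y).Walk i j, w.length ≤ 5) →
            (∃ w : (Literature.Geometry.DiscreteGeometry.bondGraph η y).Walk i k, w.length ≤ 5) →
            dist (D j) (D i) ≤ 33 / 10 → dist (D k) (D i) ≤ 33 / 10 → D j = D k → j = k) →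
          ∀ j : Fin N, dist (y i) (y j) ≤ 3 * Literature.Geometry.DiscreteGeometry.nearestDist y i →
            (∃ w : (Literature.Geometry.DiscreteGeometry.bondGraph η y).Walk i j, w.length ≤ 5) ∧
              dist (D j) (D i) ≤ 33 / 10 := by
  intro η hη hη1 N y i hpos hcf D φ s hD hs hmem hsurj hinj j hj
  obtain ⟨g, hg⟩ := hlic η hη hη1 N y i hpos hcf D φ s hD hs hmem hsurj hinj
  exact realBall_of_tracking η hη hη1 N y i hpos hcf D φ s hD hs hmem hsurj hinj (3 / 20) (157 / 40)
    (by norm_num) (by norm_num) (by norm_num) ⟨g, hg⟩ j hj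

end Summit.AtomisticToContinuum.Crystallization.Theorems
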